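import Literature.MathematicalPhysics.QuantumFieldTheory.Balaban1983to89.B9Cor35GDirInputsAtOne
import Literature.MathematicalPhysics.QuantumFieldTheory.Balaban1983to89.B9CubeDirichletCLetterAtOne
import Literature.MathematicalPhysics.QuantumFieldTheory.Balaban1983to89.B9Cor35GDirAtKnitCubeLetters

/-!
# `Balaban1983to89.B9Cor35GDirKnitInputsAtOne` — [Balaban1985BackgroundPropagators] Corollary 3.5 p. 407 («with U = 1, these theorems were proved in [4]»)
# FOR THE DIRICHLET BOND LETTER OF RECORD `G_□(U) = GDirCKY i □ (DP_□D*) (bondsOverY Ω₀(□)) U` (the cube sequence's KNIT pair, p. 409 l. 1–5): THE `U = 1`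
# INPUTS OF THE BOND-SECTOR `G`-STEP AT THE LETTER OF RECORD — the operator family `TKnitCY i □`, its `U = 1` face `(mDirC i □)♯` with BOTH site sockets
# DISCHARGED, and the three (3.42)-type `U = 1` rows of `GiK b i (TKnitCY i □ 1) B`, CONDITIONAL BY NAME on [Balaban1984PropagatorsII] Prop. 2.6 for `G(Ω)`
# (`B6.Prop26DirichletPrinted`) — seat dag-n06-c g34, FILE F1 of road (B5)'s rest (the inhabitation of the heads' `hRowsA`)

statement-level skeleton of published theorems with citation tags; proofs where landed; nothing here is a claim about the Yang–Mills mass gap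

CITATION HEADER (lean-in-tree rule).  B9 = T. Bałaban, *Propagators for lattice gauge theories in a background field*, Commun. Math. Phys. **99** (1985)
389–434 [Balaban1985BackgroundPropagators] (held `paper:balaban1985-cmp99-background-propagators`; journal page = PDF page + 388): p. 409 l. 1–5 («The operators
constructed for this sequence, which we denote by G′_□(U), C_□(U), G_□(U), satisfy all the inequalities of Theorems 3.1–3.3 correspondingly»); p. 395 («It
coincides with Δ_a in (2.19) if U = 1»); Cor. 3.5 p. 407 l. 26–35; Thm 3.3 p. 399; (3.42) p. 397; (3.12)–(3.15) p. 393 (the averaging operators of a sequence).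
[4] = B6 = T. Bałaban, *Propagators and renormalization transformations for lattice gauge theories. II*, Commun. Math. Phys. **96** (1984) 223–250
[Balaban1984PropagatorsII]: Prop. 2.6 (2.136) p. 247, p. 228, p. 248 l. 4–5.  Rows B9.Cor3.5 × B9.Thm3.3 × B6.Prop2.6 (cells only; no row head changes).

WHY THIS FILE (cell `pub-ymgap`, node N06 [B9]; dag-n06-d g35's interface ✓`B9CubeDirInverseBondCMemberRowsAtRecordY` («inhabit `CubeRowsGDirCY` and the heads' `hRowsA`
follows»)).  The bundle `CubeRowsGDirCY` is stated for the letter of record `GDirCKY i □ (DPDsDirCubeY i □ Ω₀(□)) (bondsOverY Ω₀(□))` — the Dirichlet inverse of the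
cube sequence's bond operator at its KNIT averaging pair `(QknitCubeY i □, QsknitCubeY i □)` (✓`B9Eq3115KnitCubeLetterY`).  The bond-sector `G`-step of this seat
(✓`B9Cor35GDirGStep.gStep_dirB`, ✓`B9Cor35GDirAtCubeLetters.cor35_GDir_of_pieces`) is GENERIC in the `U`-family `T`; its `U = 1` rows were instantiated (✓`B9Cor35GDirInputsAtOne
.thm33_GdK_cube_of_prop26Dirichlet`) at r05's STRAIGHT pair `deltaLocCubeY i □ parB`.  THIS FILE keys the `U = 1` inputs to the letter of record: §1 the operator family
`TKnitCY i □ U := Δ_{loc,□}[Q^knit_□](U) − DP_□(U)D*` (one `def` with body) with `GiK b i (TKnitCY i □ U) B = conj b(G_□(U)♯ℝ)` and `dirPadY 𝟙_B (TKnitCY i □ U) = padΔ_{loc,□}(U)` by `rfl`;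
§2 its `U = 1` face: `TKnitCY i □ 1 = (mDirC i □)♯` — n06-j's `hT1` reading with BOTH site-side sockets DISCHARGED (`hK` by g31's ✓`compress_mul_GpDirOneY`, `hKX` by this
seat's ✓`hKX_dirDomY`), `TKnitCY i □ 1 =` the straight letter at `U = 1`, and the regime ∕ `G_□(1)` clauses from the ONE remaining socket `hKB`; §3 ★★★ the three `U = 1` rows of
`GiK b i (TKnitCY i □ 1) B` CONDITIONAL BY NAME on `B6.Prop26DirichletPrinted` (✓`thm33_GdK_cube_of_prop26Dirichlet` re-keyed; socket `hKB` on the CANONICAL matrix `mDirC`).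

WHAT IS PROVED (1 `def` with body — `TKnitCY`; theorems; 0 sorry; 0 new named facts; standard axioms):
* §1 `TKnitCY`, `TKnitCY_apply`, `GiK_TKnitCY` (`rfl`), `dirPadY_TKnitCY` (`rfl`), `GDirCKY_restrict_eq_GiK`;
* §2 ★`TKnitCY_one_eq_liftOpY_mDirC`, `TKnitCY_one_eq_straight`, `isUnit_dirPadY_TKnitCY_one`, `GiK_TKnitCY_one_eq_conj_liftOpY`;
* §3 ★★★`thm33_GiK_knit_of_prop26Dirichlet`.

HONEST SCOPE / NOT CLAIMED.  CONDITIONAL BY NAME (D-0044): the decay is the printed assertion [4] p. 248 (`B6.Prop26DirichletPrinted`), displayed as the hypothesis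
`h26`, NOT proved; the bond socket `hKB` (a real inverse of the compression of `mDirC i □` to `bondsOverY Ω₀(□)` — the compression of a positive operator, [4]
(2.21)–(2.22)) stays DISPLAYED.  No estimate is proved here; every `U ≠ 1` statement is the business of the next files (road (B5) rest: windows at the cut field, the
compressed (3.84) split, the `G`-step at the letter of record, the covariant entries, the member-level bundle).  Nothing on `d = 4`, the continuum, reflection
positivity or the mass gap; NOT a node discharge; count-neutral; no row head changes.  NEW file; nothing landed is modified.  `--supports stmt-QuantumFields-27239`.

RELATED IN THE TREE, NOT DUPLICATED (searched 2026-08-31: `rg 'TK_one_eq|thm33_GiK_knit|GiK_TKnitCY'` over `Literature/` + `Summits/` = ∅): ✓`B9Cor35GDirInputsAtOne` (straight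
pair; USED), ✓`B9Eq3115KnitCubeLetterY` (`GDirCKY`, `GDirCKY_one_eq_liftOpY` with three sockets displayed), ✓`B9DirichletBondCubePairY` (`deltaLocCQY_sub_DPDsDirCubeY_one`),
✓`B9CubeDirichletCLetterAtOne` (`hKX_dirDomY`), ✓`B9Cor35GDirAtKnitCubeLetters` (the (3.84) split at the knit pair — the `U ≠ 1` side).
-/

noncomputable section

namespace Literature.MathematicalPhysics.QuantumFieldTheory.Balaban1983to89.B9Cor35GDirKnitInputsAtOne

open B6RandomWalk (HasMajorant)
open B9Thm34Ext (toB6)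
open B9Eq352DivFormLetters (conj)
open B6KLevelCensusIndexV1 (KIdx)
open B6Cover236MultiLevelBlocks (cubes)
open B9CubeLettersBondOpsL0 (BlkCubeY)
open B9CubeGeometryInputs (geoCK)
open B9Cor35GCubeInputsAtOne (blkBK DK LapK)
open B9Cor35GpDirInputsAtOne (dirDomY GpDirOneY)
open B9Cor35GDirInputsAtOne (GiK GdK DadK mDirC mlocDirCMatY_eq_mDirC thm33_GdK_cube_of_prop26Dirichlet geoDirBI domDirBI admDirBI GDirBFam)
open B9CubeDirichletLetterAtOne (compress_mul_GpDirOneY)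
open B9CubeDirichletCLetterAtOne (kxDirY hKX_dirDomY)
open B9Eq3105DirichletBondLettersAtOneY (deltaLocCubeY_one_liftMatY)
open B9DirichletBondCubePairY (deltaLocCQY padDeltaLocCY deltaLocCQY_one_liftMatY deltaLocCQY_sub_DPDsDirCubeY_one)
open B9Eq3115KnitCubeLetterY (QknitCubeY QsknitCubeY GDirCKY QknitCubeY_one_liftMatY QsknitCubeY_one)
open Node00 (SiteY FBondY CfgY BondParY toKT liftOpY)
open Node00.OpsYLocalInverse (dirPadY dirInvY)
open Node00.OpsYCubeDirInverse (indDiagY)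
open Node00.OpsYCubeDirInverseBond (indProjY bondsOverY isUnit_dirPadY_indProjY_liftOpY dirInvY_indProjY_liftOpY)
open Node00.OpsYCubeProjectionG (DPDsDirCubeY)
open scoped Matrix Matrix.Norms.L2Operator

variable {d ℓ : ℕ} {hd : 1 ≤ d + 1} {hL : Odd (ℓ + 1) ∧ 1 < ℓ + 1} {b₀ b₁ : ℝ} {N : ℕ} [Nonempty (Fin N)]

/-! ## §1  The operator family of the letter of record and its realified letters -/

section Family

variable (i : KIdx d ℓ hd hL b₀ b₁) (c : ↥(cubes (toKT i).D.toDomains))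

/-- **THE BOND OPERATOR FAMILY OF THE LETTER OF RECORD** `TKnitCY i □ U := Δ_{loc,□}[Q^knit_□](U) − DP_□(U)D*` — the cube sequence's bond operator at its knit
averaging pair minus def-Y's Dirichlet projection word at `Ω₀(□) = dirDomY i □` (the `T`-slot of ✓`gStep_dirB` ∕ ✓`cor35_GDir_of_pieces` for `G_□(U)` of p. 409).
[cite: Balaban1985BackgroundPropagators, (3.26) p.395, p.409 l.1–5 («G_□(U)»), (3.12)–(3.15) p.393] -/
def TKnitCY (U : CfgY (Matrix (Fin N) (Fin N) ℂ) i) : (FBondY i → Matrix (Fin N) (Fin N) ℂ) →ₗ[ℂ] (FBondY i → Matrix (Fin N) (Fin N) ℂ) :=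
  deltaLocCQY i c (QknitCubeY i c) (QsknitCubeY i c) U - DPDsDirCubeY i c (dirDomY i c) U

/-- `TKnitCY`, unfolded (`rfl`). [cite: Balaban1985BackgroundPropagators, (3.26) p.395, bookkeeping] -/
theorem TKnitCY_apply (U : CfgY (Matrix (Fin N) (Fin N) ℂ) i) :
    TKnitCY i c U = deltaLocCQY i c (QknitCubeY i c) (QsknitCubeY i c) U - DPDsDirCubeY i c (dirDomY i c) U := rfl

variable {ι : Type} [Fintype ι] (b : Module.Basis ι ℝ (Matrix (Fin N) (Fin N) ℂ))

/-- ★ **THE INTERIOR LETTER OF THE `G`-STEP AT `TKnitCY` IS THE REALIFIED LETTER OF RECORD**: `GiK b i (TKnitCY i □ U) (bondsOverY Ω₀(□)) = conj b(G_□(U)♯ℝ)` (`rfl`).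
[cite: Balaban1985BackgroundPropagators, p.409 l.1–5 («G_□(U)»), (3.27) p.395, bookkeeping] -/
theorem GiK_TKnitCY (U : CfgY (Matrix (Fin N) (Fin N) ℂ) i) :
    GiK b i (TKnitCY i c U) (bondsOverY i (dirDomY i c)) =
      conj b ((GDirCKY i c (DPDsDirCubeY i c (dirDomY i c)) (bondsOverY i (dirDomY i c)) U).restrictScalars ℝ) := rfl

/-- ★ **THE PADDED OPERATOR OF THE `G`-STEP AT `TKnitCY` IS THE REGIME OBJECT OF RECORD**: `dirPadY 𝟙_B (TKnitCY i □ U) = padDeltaLocCY i □ Q^knit Q^knit* (DP_□D*) B U` (`rfl`).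
[cite: Balaban1985BackgroundPropagators, p.409 l.1–5, Cor. 3.6 p.408, p.394, bookkeeping] -/
theorem dirPadY_TKnitCY (U : CfgY (Matrix (Fin N) (Fin N) ℂ) i) :
    dirPadY (indProjY (bondsOverY i (dirDomY i c))) (TKnitCY i c U) =
      padDeltaLocCY i c (QknitCubeY i c) (QsknitCubeY i c) (DPDsDirCubeY i c (dirDomY i c)) (bondsOverY i (dirDomY i c)) U := rfl

/-- the letter of record, realified, IS `GiK` at `TKnitCY` (the symmetric reading of `GiK_TKnitCY`). [cite: Balaban1985BackgroundPropagators, p.409 l.1–5, bookkeeping] -/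
theorem GDirCKY_restrict_eq_GiK (U : CfgY (Matrix (Fin N) (Fin N) ℂ) i) :
    conj b ((GDirCKY i c (DPDsDirCubeY i c (dirDomY i c)) (bondsOverY i (dirDomY i c)) U).restrictScalars ℝ) =
      GiK b i (TKnitCY i c U) (bondsOverY i (dirDomY i c)) := rfl

end Family

/-! ## §2  The `U = 1` face of `TKnitCY`: both site sockets discharged, the bond socket `hKB` displayed on the canonical matrix -/

section One

variable (i : KIdx d ℓ hd hL b₀ b₁) (c : ↥(cubes (toKT i).D.toDomains))

/-- ★ **`TKnitCY i □ 1 = (mDirC i □)♯`** — n06-j's `hT1` reading `Δ_{loc,□}[Q^knit_□](1) − DP_□(1)D* = (mlocDirCMatY i □ Ω₀(□) K K_X)♯` at g31's site kernel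
`K = GpDirOneY i □` and this seat's block kernel `K_X = kxDirY i □`, with BOTH site-side sockets DISCHARGED (`hK` := ✓`compress_mul_GpDirOneY`, `hKX` := ✓`hKX_dirDomY`)
and the matrix identified with the canonical `mDirC i □` (✓`mlocDirCMatY_eq_mDirC`). [cite: Balaban1985BackgroundPropagators, p.395 («coincides with Δ_a in (2.19) if U = 1»), (3.25)–(3.26) pp.394–395, p.409 l.1–5, Cor. 3.5 p.407] -/
theorem TKnitCY_one_eq_liftOpY_mDirC : TKnitCY i c (fun _ _ => 1) = liftOpY (Matrix (Fin N) (Fin N) ℂ) (mDirC i c) := by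
  rw [TKnitCY_apply, deltaLocCQY_sub_DPDsDirCubeY_one i (QknitCubeY i c) (QsknitCubeY i c) (QknitCubeY_one_liftMatY i c) (QsknitCubeY_one i c)
    (dirDomY i c) (compress_mul_GpDirOneY i c) (hKX_dirDomY i c), mlocDirCMatY_eq_mDirC i c (hKX_dirDomY i c)]

/-- ★ **AT `U = 1` THE KNIT LETTER IS THE STRAIGHT LETTER**: for any bond transporter `parB` trivial at `U = 1`,
`TKnitCY i □ 1 = deltaLocCubeY i □ parB 1 − DP_□(1)D*` (both averaging pairs have the flat faces `q_□♯`, `q*_□♯` at `U = 1`).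
[cite: Balaban1985BackgroundPropagators, p.395 («if U = 1»), (3.12)–(3.15) p.393, p.409 l.1–5] -/
theorem TKnitCY_one_eq_straight {parB : BondParY (Matrix (Fin N) (Fin N) ℂ) i} (hparB : ∀ s s', parB (fun _ _ => 1) s s' = 1) :
    TKnitCY i c (fun _ _ => 1) = B9Eq3105AtLetters.deltaLocCubeY i c parB (fun _ _ => 1) - DPDsDirCubeY i c (dirDomY i c) (fun _ _ => 1) := by
  rw [TKnitCY_apply, deltaLocCQY_one_liftMatY i (QknitCubeY i c) (QsknitCubeY i c) (QknitCubeY_one_liftMatY i c) (QsknitCubeY_one i c),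
    ← deltaLocCubeY_one_liftMatY i (q := c) hparB]

variable {KB : Matrix (FBondY i) (FBondY i) ℝ}

/-- ★ **THE REGIME AT `U = 1` FROM THE ONE REMAINING SOCKET**: a real `K_B` inverting the compression of the canonical `mDirC i □` to `B = bondsOverY Ω₀(□)` makes
`dirPadY 𝟙_B (TKnitCY i □ 1) = padΔ_{loc,□}(1)` a unit. [cite: Balaban1985BackgroundPropagators, p.394 («Its inverse is denoted by G′»), Cor. 3.5 p.407, p.409 l.1–5; Balaban1983RegularityDecay, (2.42) p.584] -/
theorem isUnit_dirPadY_TKnitCY_one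
    (hKB : (mDirC i c).submatrix (fun v : ↥(bondsOverY i (dirDomY i c)) => (v : FBondY i)) (fun v : ↥(bondsOverY i (dirDomY i c)) => (v : FBondY i)) *
      KB.submatrix (fun v : ↥(bondsOverY i (dirDomY i c)) => (v : FBondY i)) (fun v : ↥(bondsOverY i (dirDomY i c)) => (v : FBondY i)) = 1) :
    IsUnit (dirPadY (indProjY (bondsOverY i (dirDomY i c))) (TKnitCY (N := N) i c (fun _ _ => 1))) := by
  rw [TKnitCY_one_eq_liftOpY_mDirC]; exact isUnit_dirPadY_indProjY_liftOpY _ hKB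

variable {ι : Type} [Fintype ι] (b : Module.Basis ι ℝ (Matrix (Fin N) (Fin N) ℂ))

/-- ★ **`G_□(1)♯ℝ = conj b((𝟙_B K_B 𝟙_B)♯)`** — the interior letter at `U = 1` is the lift of the compressed real inverse (def-Y's lift clause).
[cite: Balaban1985BackgroundPropagators, (3.27) p.395, p.409 l.1–5, Cor. 3.5 p.407; Balaban1983RegularityDecay, (2.42) p.584] -/
theorem GiK_TKnitCY_one_eq_conj_liftOpY
    (hKB : (mDirC i c).submatrix (fun v : ↥(bondsOverY i (dirDomY i c)) => (v : FBondY i)) (fun v : ↥(bondsOverY i (dirDomY i c)) => (v : FBondY i)) *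
      KB.submatrix (fun v : ↥(bondsOverY i (dirDomY i c)) => (v : FBondY i)) (fun v : ↥(bondsOverY i (dirDomY i c)) => (v : FBondY i)) = 1) :
    GiK b i (TKnitCY i c (fun _ _ => 1)) (bondsOverY i (dirDomY i c)) =
      conj b ((liftOpY (Matrix (Fin N) (Fin N) ℂ) (indDiagY (bondsOverY i (dirDomY i c)) * KB * indDiagY (bondsOverY i (dirDomY i c)))).restrictScalars ℝ) := by
  rw [GiK, TKnitCY_one_eq_liftOpY_mDirC, dirInvY_indProjY_liftOpY _ hKB]

end One

/-! ## §3  ★★★ The three `U = 1` rows of the letter of record, conditional by name on [4] Prop. 2.6 for `G(Ω)` -/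

section Rows

variable {ι : Type} [Fintype ι] (b : Module.Basis ι ℝ (Matrix (Fin N) (Fin N) ℂ))

/-- ★★★ **THEOREM 3.3 AT `U = 1` FOR THE REALIFIED DIRICHLET BOND LETTER OF RECORD OF EVERY CUBE OF EVERY MEMBER, ONE SET OF CONSTANTS — CONDITIONAL BY NAME ON
[4] PROP. 2.6 FOR `G(Ω)`**: IF `B6.Prop26DirichletPrinted` holds at the print-faithful family (✓`B9Cor35GDirInputsAtOne` §3), THEN there are `M₁, δ₃, C > 0` such that
for every member `i` above the threshold `M₁ ≤ L·M_h`, every cover cube `□`, every `Rr, H` and every real `K_B` inverting the compression of the canonical matrix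
`mDirC i □` to `B = bondsOverY Ω₀(□)`: `GiK b i (TKnitCY i □ 1) B ≺ C(Lⁿη)²e^{−δ₃d}`, `conj b(∇_ν)·GiK ≺ C(Lⁿη)e^{−δ₃d}` (all `ν`), `conj b(Δ)·GiK ≺ Ce^{−δ₃d}` over
`toB6 (geoCK i □) Rr H` keyed by `blkBK i □` — the `hG ∕ hDG ∕ hLapG` binders of the bond-sector `G`-step AT THE LETTER OF RECORD.  The decay is the NAMED printed
assertion (hypothesis `h26`), not proved here; the site sockets are discharged, the bond socket `hKB` is displayed.
[cite: Balaban1985BackgroundPropagators, Thm 3.3 p.399, (3.42) p.397, Cor. 3.5 p.407, p.409 l.1–5; Balaban1984PropagatorsII, Prop. 2.6 (2.136) p.247, p.228, p.248 l.4–5, (2.51) p.232] -/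
theorem thm33_GiK_knit_of_prop26Dirichlet
    (h26 : B6.Prop26DirichletPrinted (geoDirBI (d := d) (ℓ := ℓ) (hd := hd) (hL := hL) (b₀ := b₀) (b₁ := b₁)) domDirBI admDirBI GDirBFam) :
    ∃ M₁ δ₃ C : ℝ, 0 < M₁ ∧ 0 < δ₃ ∧ 0 < C ∧
    ∀ (i : KIdx d ℓ hd hL b₀ b₁) (q : ↥(cubes (toKT i).D.toDomains)) (Rr : ℝ) (H : Prop) (KB : Matrix (FBondY i) (FBondY i) ℝ),
      (mDirC i q).submatrix (fun v : ↥(bondsOverY i (dirDomY i q)) => (v : FBondY i)) (fun v : ↥(bondsOverY i (dirDomY i q)) => (v : FBondY i)) *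
        KB.submatrix (fun v : ↥(bondsOverY i (dirDomY i q)) => (v : FBondY i)) (fun v : ↥(bondsOverY i (dirDomY i q)) => (v : FBondY i)) = 1 →
      M₁ ≤ ((ℓ : ℝ) + 1) * i.Mh →
      HasMajorant (g := toB6 (geoCK i q) Rr H) (blkBK i q) (GiK b i (TKnitCY i q (fun _ _ => 1)) (bondsOverY i (dirDomY i q)))
          (fun a a' => C * (geoCK i q).len a ^ 2 * Real.exp (-(δ₃ * (geoCK i q).dist a a'))) ∧
      (∀ ν : Fin (d + 1), HasMajorant (g := toB6 (geoCK i q) Rr H) (blkBK i q) (DK b i ν * GiK b i (TKnitCY i q (fun _ _ => 1)) (bondsOverY i (dirDomY i q)))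
          (fun a a' => C * (geoCK i q).len a * Real.exp (-(δ₃ * (geoCK i q).dist a a')))) ∧
      HasMajorant (g := toB6 (geoCK i q) Rr H) (blkBK i q) (LapK b i * GiK b i (TKnitCY i q (fun _ _ => 1)) (bondsOverY i (dirDomY i q)))
          (fun a a' => C * Real.exp (-(δ₃ * (geoCK i q).dist a a'))) := by
  obtain ⟨M₁, δ₃, C, hM₁, hδ₃, hC, H⟩ := thm33_GdK_cube_of_prop26Dirichlet (𝔸 := Matrix (Fin N) (Fin N) ℂ) b h26
  refine ⟨M₁, δ₃, C, hM₁, hδ₃, hC, fun i q Rr Hh KB hKB hM => ?_⟩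
  have hKB' : (B9Eq3105DirichletBondLettersAtOneY.mlocDirCMatY i q (dirDomY i q) (GpDirOneY i q) (kxDirY i q)).submatrix
        (fun v : ↥(bondsOverY i (dirDomY i q)) => (v : FBondY i)) (fun v : ↥(bondsOverY i (dirDomY i q)) => (v : FBondY i)) *
      KB.submatrix (fun v : ↥(bondsOverY i (dirDomY i q)) => (v : FBondY i)) (fun v : ↥(bondsOverY i (dirDomY i q)) => (v : FBondY i)) = 1 := by
    rw [mlocDirCMatY_eq_mDirC i q (hKX_dirDomY i q)]; exact hKB
  have h := H i q Rr Hh (fun _ _ _ => 1) (kxDirY i q) KB (fun _ _ => rfl) (hKX_dirDomY i q) hKB' hM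
  rwa [← TKnitCY_one_eq_straight i q (parB := fun _ _ _ => 1) (fun _ _ => rfl)] at h

end Rows

end Literature.MathematicalPhysics.QuantumFieldTheory.Balaban1983to89.B9Cor35GDirKnitInputsAtOne

end
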